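import Summits.CriticalPhenomena.Ising3D.TaylorRegionBoxInputs
import HarnessLib

/-!
# Fixture: the even-region checker runs in the kernel (toy `Λ = 1` functional)
(cell `pub-ising3x`, seat recog-1 gen 11; gate (g2): end-to-end computability test of the kernel-route region
pipeline `kernelPDLI → substThetaI → halfStripPos → taylorEvenRegion_of_evenRegionCheck`, by `decide +kernel`)

HONEST FRAMING: lottery ticket; floor = tightest certified 3D Ising CFT bounds; no exact-solution
claim without a proof.

Toy data (NOT a certificate): index list `[(1,0)]`, weights `c₁ = c₂ = 1` (rows 0, 1), `c₄ = c₅ = 0`, the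
one-point "box" `Q = {(½, 3/2)}` with thin enclosures, `cc = 0`, `E₀ = P₀ = 4`. Then `K_X,sym = 2(u+v) - 2`,
`K_Y,sym = 2(u+v) - 6`, `K_Z = 0`, and the three half-strip tests pass (`P₁ = 8`, one θ-cell, depth 3) —
`toyEvenRegionData_check` is `decide +kernel`, and `taylorEvenRegion_toy` is the region obligation it yields;
likewise `toyOddConeRegionData_check` / `oddCone_toy` for the odd cone (`Ψ = 1·taylorCoeffAt (0,0)`, `κ₀ = 1`),
and the TURNKEY forms `toyEvenRegionCert_check` (a box of positive width) / `toyOddConeRegionCert_check`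
(root atoms through `checkRoot`) of `TaylorRegionBoxInputs`.
[folklore]
-/

namespace Summit.CriticalPhenomena.Ising3D

open Literature.Analysis.ValidatedNumerics Literature.Analysis.ValidatedNumerics.PolyMP
open Literature.Analysis.ValidatedNumerics.NumericsMP (MI)
open Literature.MathematicalPhysics.QuantumFieldTheory.ConformalBootstrap3D

/-- Toy weights: rows 0 and 1 carry weight `1` on `(1,0)`, the others `0`. [folklore] -/
def toyWeights : Fin 5 → ℕ × ℕ → ℚ := fun i _ => if i = 0 ∨ i = 1 then 1 else 0

/-- Toy even-region data (scale `2^10`). [folklore] -/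
def toyEvenRegionData : EvenRegionData where
  S := 1024
  l := [(1, 0)]
  cQ := toyWeights
  sσI := PolyMP.ofRat 1024 (1 / 2)
  sεI := PolyMP.ofRat 1024 (3 / 2)
  sbI := PolyMP.ofRat 1024 1
  ccQ := 0
  P0 := 4
  N := 2
  prmX := ⟨1, 8, 1, 3⟩
  prmY := ⟨1, 8, 1, 3⟩
  prmD := ⟨1, 8, 1, 3⟩

/-- **The toy check evaluates to `true` in the kernel.** [folklore] -/
theorem toyEvenRegionData_check : toyEvenRegionData.check = true := by
  decide +kernel

/-- The region obligation produced by the toy check. [folklore] -/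
theorem taylorEvenRegion_toy :
    TaylorEvenRegion (taylorCrossing (1 / 2) (1 / 2) toyEvenRegionData.l.toFinset
      fun i ab => (toyEvenRegionData.cQ i ab : ℝ)) {((1 : ℝ) / 2, (3 : ℝ) / 2)}
      ((toyEvenRegionData.P0 : ℝ) + toyEvenRegionData.ccQ) := by
  refine taylorEvenRegion_of_evenRegionCheck toyEvenRegionData (by decide) _ (fun p hp => ?_)
    toyEvenRegionData_check
  rw [Set.mem_singleton_iff] at hp
  subst hp
  refine ⟨?_, ?_, ?_⟩
  · have h := mem_ofRat 1024 (1 / 2 : ℚ); push_cast at h; exact h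
  · have h := mem_ofRat 1024 (3 / 2 : ℚ); push_cast at h; exact h
  · have h := mem_ofRat 1024 (1 : ℚ); push_cast at h; norm_num; exact h

/-! ### Toy odd-cone check -/

/-- Toy odd-sector weights: row 3 (`K₄`) carries weight `1` on `(1,0)`; rows 2, 4 vanish. [folklore] -/
def toyOddWeights : Fin 5 → ℕ × ℕ → ℚ := fun i _ => if i = 3 then 1 else 0

/-- Toy odd-cone data: `Ψ` = weight `1` on `(0,0)` (so `K_{ψ,0} = K_{ψ,t} = 1`), `κ₀ = 1`, one-point box
`(½, 3/2)` with the INTEGER-exponent scalars `κ₁ = ¼`, `κ₂ = ½`, `κ₃ = 8` (thin), `E_T = P₀ = 4`. [folklore] -/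
def toyOddConeRegionData : OddConeRegionData where
  S := 1024
  l := [(1, 0)]
  cQ := toyOddWeights
  lψ := [(0, 0)]
  ψQ := fun _ => 1
  κ₀Q := 1
  sσI := PolyMP.ofRat 1024 (1 / 2)
  sbI := PolyMP.ofRat 1024 1
  stI := PolyMP.ofRat 1024 (-1)
  K1 := PolyMP.ofRat 1024 (1 / 4)
  K2 := PolyMP.ofRat 1024 (1 / 2)
  K3 := PolyMP.ofRat 1024 8
  ccQ := 0
  P0 := 4
  N := 2
  prmM1 := ⟨1, 8, 1, 3⟩
  prmM2 := ⟨1, 8, 1, 3⟩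
  prmR1 := ⟨1, 8, 1, 3⟩
  prmR2 := ⟨1, 8, 1, 3⟩

/-- **The toy odd-cone check evaluates to `true` in the kernel.** [folklore] -/
theorem toyOddConeRegionData_check : toyOddConeRegionData.check = true := by
  decide +kernel

/-- The odd-cone obligation produced by the toy check (box = the point `(½, 3/2)`). [folklore] -/
theorem oddCone_toy : ∀ p ∈ ({((1 : ℝ) / 2, (3 : ℝ) / 2)} : Set (ℝ × ℝ)), ∀ (E : ℝ) (j : ℕ),
    (toyOddConeRegionData.P0 : ℝ) + toyOddConeRegionData.ccQ ≤ E → (j : ℝ) ≤ E →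
      OddConeAt (taylorCrossing (1 / 2) (1 / 2) toyOddConeRegionData.l.toFinset
          fun i ab => (toyOddConeRegionData.cQ i ab : ℝ))
        (∑ ab ∈ toyOddConeRegionData.lψ.toFinset,
          (toyOddConeRegionData.ψQ ab : ℝ) • taylorCoeffAt (1 / 2) (1 / 2) ab)
        (toyOddConeRegionData.κ₀Q : ℝ) p.1 p.2 E j := by
  refine oddCone_of_oddConeRegionCheck toyOddConeRegionData (by decide) (by decide) _ (fun p hp => ?_)
    toyOddConeRegionData_check
  rw [Set.mem_singleton_iff] at hp
  subst hp
  have e1 : (1 : ℝ) / 2 + 3 / 2 = (2 : ℕ) := by norm_num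
  have e2 : (3 : ℝ) / 2 - 1 / 2 = (1 : ℕ) := by norm_num
  have e3 : -(2 * ((3 : ℝ) / 2)) = -((3 : ℕ) : ℝ) := by norm_num
  refine ⟨?_, ?_, ?_, ?_, ?_, ?_⟩
  · have h := mem_ofRat 1024 (1 / 2 : ℚ); push_cast at h; exact h
  · have h := mem_ofRat 1024 (1 : ℚ); push_cast at h; norm_num; exact h
  · have h := mem_ofRat 1024 (-1 : ℚ); push_cast at h; norm_num at h ⊢; exact h
  · have h := mem_ofRat 1024 (1 / 4 : ℚ); push_cast at h
    rw [show ((1 : ℝ) / 2, (3 : ℝ) / 2).1 + ((1 : ℝ) / 2, (3 : ℝ) / 2).2 = ((2 : ℕ) : ℝ) by norm_num,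
      Real.rpow_natCast]
    norm_num
    exact h
  · have h := mem_ofRat 1024 (1 / 2 : ℚ); push_cast at h
    rw [show ((1 : ℝ) / 2, (3 : ℝ) / 2).2 - ((1 : ℝ) / 2, (3 : ℝ) / 2).1 = ((1 : ℕ) : ℝ) by norm_num,
      Real.rpow_natCast, pow_one]
    exact h
  · have h := mem_ofRat 1024 (8 : ℚ); push_cast at h
    rw [show -(2 * ((1 : ℝ) / 2, (3 : ℝ) / 2).2) = -((3 : ℕ) : ℝ) by norm_num,
      Real.rpow_neg (by norm_num), Real.rpow_natCast]
    norm_num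
    exact h

/-! ### Turnkey toys (box inputs produced from rational data; root atoms checked in the kernel) -/

/-- Turnkey even toy: box `[1/2, 0.51] × [3/2, 1.51]`, same weights, `E₀ = 4`. [folklore] -/
def toyEvenRegionCert : EvenRegionCert where
  S := 1024
  box := ⟨1 / 2, 51 / 100, 3 / 2, 151 / 100⟩
  l := [(1, 0)]
  cQ := toyWeights
  ccQ := 0
  P0 := 4
  N := 2
  prmX := ⟨1, 8, 1, 3⟩
  prmY := ⟨1, 8, 1, 3⟩
  prmD := ⟨1, 8, 1, 3⟩

/-- [folklore] -/
theorem toyEvenRegionCert_check : toyEvenRegionCert.check = true := by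
  decide +kernel

/-- The even region for the toy BOX (positive width in both directions). [folklore] -/
theorem taylorEvenRegion_toyCert :
    TaylorEvenRegion (taylorCrossing (1 / 2) (1 / 2) toyEvenRegionCert.l.toFinset
      fun i ab => (toyEvenRegionCert.cQ i ab : ℝ)) toyEvenRegionCert.box.toSet
      ((toyEvenRegionCert.P0 : ℝ) + toyEvenRegionCert.ccQ) :=
  taylorEvenRegion_of_cert _ toyEvenRegionCert_check

/-- Turnkey odd toy: the point box `(½, 3/2)` with EXACT root atoms `(½)^2 = ¼`, `(½)^1 = ½`, `2^3 = 8`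
(checked by `checkRoot` in the kernel). [folklore] -/
def toyOddConeRegionCert : OddConeRegionCert where
  S := 1024
  box := ⟨1 / 2, 1 / 2, 3 / 2, 3 / 2⟩
  l := [(1, 0)]
  cQ := toyOddWeights
  lψ := [(0, 0)]
  ψQ := fun _ => 1
  κ₀Q := 1
  k1lo := ⟨2, 1, ⟨256, 256⟩⟩
  k1hi := ⟨2, 1, ⟨256, 256⟩⟩
  k2lo := ⟨1, 1, ⟨512, 512⟩⟩
  k2hi := ⟨1, 1, ⟨512, 512⟩⟩
  k3lo := ⟨3, 1, ⟨8192, 8192⟩⟩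
  k3hi := ⟨3, 1, ⟨8192, 8192⟩⟩
  ccQ := 0
  P0 := 4
  N := 2
  prmM1 := ⟨1, 8, 1, 3⟩
  prmM2 := ⟨1, 8, 1, 3⟩
  prmR1 := ⟨1, 8, 1, 3⟩
  prmR2 := ⟨1, 8, 1, 3⟩

/-- [folklore] -/
theorem toyOddConeRegionCert_check : toyOddConeRegionCert.check = true := by
  decide +kernel

/-- The odd cone for the toy point box through the turnkey certificate. [folklore] -/
theorem oddCone_toyCert : ∀ p ∈ toyOddConeRegionCert.box.toSet, ∀ (E : ℝ) (j : ℕ),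
    (toyOddConeRegionCert.P0 : ℝ) + toyOddConeRegionCert.ccQ ≤ E → (j : ℝ) ≤ E →
      OddConeAt (taylorCrossing (1 / 2) (1 / 2) toyOddConeRegionCert.l.toFinset
          fun i ab => (toyOddConeRegionCert.cQ i ab : ℝ))
        (∑ ab ∈ toyOddConeRegionCert.lψ.toFinset,
          (toyOddConeRegionCert.ψQ ab : ℝ) • taylorCoeffAt (1 / 2) (1 / 2) ab)
        (toyOddConeRegionCert.κ₀Q : ℝ) p.1 p.2 E j :=
  oddCone_of_cert _ toyOddConeRegionCert_check

end Summit.CriticalPhenomena.Ising3D
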